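import Literature.AnabelianGeometry.EtaleTheta.MuTwoSettingCLevel
import Literature.AnabelianGeometry.EtaleTheta.Thm16SubdagCompanion
import HarnessLib

/-!
# [EtTh] §2: the automorphism pair `(α, β)` of an OUTER conjugator `g ∈ Π^tp_C` at a `MuTwoSetting` with
# C-level data — `α = conj_g|_{Π^tp_X}`, `β = ` its theta companion (support lemmas)

Mochizuki, *The Étale Theta Function …* [EtTh], Publ. RIMS 45 (2009): Def 1.7 p.27 ("`X^log → C^log`", `Π^tp_C`),
Thm 1.6 (ii) p.24 ("`γ` induces an isomorphism `(Δ_Θ)_α ⥲ (Δ_Θ)_β`" — the theta companion), Cor 2.8 (iii) p.42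
("if `γ` arises from an inner automorphism of `Π^tp_{Ċ̲̲}` …") [cite: MochizukiEtTh2009, Cor 2.8(iii) p.42].

PROOF-ONLY support file (no `def`, no instance, no new `Prop`; cell abc-iut, layer L2, seat abc-iut-w6-d051, sequel of
the OUTER chain p434590 → p436384 → p436513 → p437630 for node EtTh:Cor2.8(iii) clauses 3–4). After that chain the
outer clauses of `ThetaOrbitData.Cor28_iii` / `Cor28_i` at `ThetaOrbitData.ofEmbedding ε hC hS` hold for a conjugator
`x ∈ Π^tp_C` modulo: the PAIR EQUATIONS of an automorphism pair `(α : Π^tp_X ≃ₜ* Π^tp_X, β : (Π^tp_X)^Θ ≃ₜ* (Π^tp_X)^Θ)`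
(`ι ∘ α = conj_x ∘ ι`, `β ∘ toTheta = toTheta ∘ α`), the identification `ι(Π^tp_{X̲}) = T.tp T.PiXu`, and P-C5.
THIS file discharges the first item at abc-iut-L2-d3's C-level record `MuTwoSetting.CLevelData` (`Π^tp_X ↪ Π^tp_C` an OPEN
EMBEDDING, p430305-lineage) under the quotient-map property of `toTheta` (sub-DAG debt R3 of abc-iut-L6-d5's
`Thm16SubdagCompanion`, true at the finer §1 model `ThetaSetting.model₂`): for EVERY `g ∈ Π^tp_C`,
* `CLevelData.outer_pair_equations` — the pair `(CLevelData.conjX e g, Thm16Sub.topCompanion … (conjX e g) …)` satisfies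
  `inclX (α σ) = g · inclX σ · g⁻¹` and `β (toTheta σ) = toTheta (α σ)`, and `β(Δ_Θ) = Δ_Θ`;
* `CLevelData.exists_outer_pair` — hence an automorphism pair with the two equations EXISTS (the shape consumed, with
  `ι := inclX`, by `OrbitEmbedding.ofEmbedding_cor28_iii_outer_reduced` of `Discharge/Sec2OrbitEmbeddingOuterBinders`).
Nothing asserts that `CLevelData` / `IsQuotientMap toTheta` hold for an actual curve (they are the model's data);
[EtTh] is refereed; no side is taken on [IUTchIII] Cor 3.12; typed ≠ proved.
-/

noncomputable section

namespace Literature.AnabelianGeometry.EtaleTheta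

open Literature.AnabelianGeometry.SemiGraphs
open _root_.Topology

variable {p : ℕ} [Fact p.Prime]

namespace MuTwoSetting.CLevelData

variable {M : MuTwoSetting p} (e : M.CLevelData)

/-- **The pair equations at the C-level record**: for `g ∈ Π^tp_C`, `α := conjX e g` (the inner automorphism of
`Π^tp_C` restricted along the open embedding `inclX`) and `β :=` its topological theta companion
(`Thm16Sub.topCompanion`, granted `IsQuotientMap toTheta`) satisfy `inclX ∘ α = conj_g ∘ inclX`,
`β ∘ toTheta = toTheta ∘ α`, and `β(Δ_Θ) = Δ_Θ`. [cite: MochizukiEtTh2009, Thm 1.6 (ii) p.24] -/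
theorem outer_pair_equations (hq : IsQuotientMap M.toTheta) (g : M.GtpC) :
    (∀ σ : M.PiTemp, M.inclX (e.conjX g σ) = g * M.inclX σ * g⁻¹) ∧
    (∀ σ : M.PiTemp,
      Thm16Sub.topCompanion M.toThetaSetting M.toThetaSetting (e.conjX g) (e.map_deltaTemp_conjX g) hq hq
          (M.toTheta σ) = M.toTheta (e.conjX g σ)) ∧
    M.DeltaTheta.map (Thm16Sub.topCompanion M.toThetaSetting M.toThetaSetting (e.conjX g)
        (e.map_deltaTemp_conjX g) hq hq).toMonoidHom = M.DeltaTheta := by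
  refine ⟨fun σ => e.inclX_conjX g σ, fun σ => ?_, ?_⟩
  · rw [Thm16Sub.topCompanion_apply]
    exact Thm16Sub.algCompanion_apply_toTheta _ _ _ _ σ
  · exact Thm16Sub.algCompanion_map_deltaTheta _ _ (e.conjX g) (e.map_deltaTemp_conjX g)

include e in
/-- **An automorphism pair EXISTS for every outer conjugator** `g ∈ Π^tp_C` at the C-level record (granted
`IsQuotientMap toTheta`): `∃ α β, inclX ∘ α = conj_g ∘ inclX ∧ β ∘ toTheta = toTheta ∘ α ∧ β^{±1}(Δ_Θ) ⊆ Δ_Θ` — the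
residual «pair equations» of the OUTER Cor 2.8 chain, discharged with `ι := inclX`.
[cite: MochizukiEtTh2009, Cor 2.8(iii) p.42] -/
theorem exists_outer_pair (hq : IsQuotientMap M.toTheta) (g : M.GtpC) :
    ∃ (α : M.PiTemp ≃ₜ* M.PiTemp) (β : M.GtpTheta ≃ₜ* M.GtpTheta),
      (∀ σ : M.PiTemp, M.inclX (α σ) = g * M.inclX σ * g⁻¹) ∧
      (∀ σ : M.PiTemp, β (M.toTheta σ) = M.toTheta (α σ)) ∧
      (∀ a, a ∈ M.DeltaTheta → β a ∈ M.DeltaTheta) ∧ (∀ a, a ∈ M.DeltaTheta → β.symm a ∈ M.DeltaTheta) := by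
  obtain ⟨h₁, h₂, h₃⟩ := e.outer_pair_equations hq g
  refine ⟨e.conjX g, _, h₁, h₂, fun a ha => h₃.le ⟨a, ha, rfl⟩, fun a ha => ?_⟩
  obtain ⟨b, hb, hba⟩ := h₃.ge ha
  have : (Thm16Sub.topCompanion M.toThetaSetting M.toThetaSetting (e.conjX g) (e.map_deltaTemp_conjX g)
      hq hq).symm a = b := by
    rw [ContinuousMulEquiv.symm_apply_eq]
    exact hba.symm
  rw [this]
  exact hb

/-- For an INNER conjugator `g = inclX y` the pair's first component IS conjugation by `y` on `Π^tp_X`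
(abc-iut-L2-d3's `conjX_inclX`), so the outer chain specialises to abc-iut-L2-t2's inner files.
[cite: MochizukiEtTh2009, Cor 2.8(iii) p.42] -/
theorem conjX_inclX_apply (y σ : M.PiTemp) : e.conjX (M.inclX y) σ = y * σ * y⁻¹ :=
  e.conjX_inclX y σ

end MuTwoSetting.CLevelData

end Literature.AnabelianGeometry.EtaleTheta

end
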